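import Mathlib.FieldTheory.Fixed
import Mathlib.FieldTheory.PrimitiveElement
import HarnessLib

/-!
# FiniteAutSeparator — a simultaneous separator for a finite family of field automorphisms (two-storey cell, STEP B′)
(decomp-res lens-1 g28 preparation J; NEXT-g29-E2 STEP B′)

For a finite family `G` of ring automorphisms of a field `L`, closed under composition and containing `1`, there is
ONE element `θ ∈ L` moved
by every `g ∈ G` other than `1` (`exists_separator`): `G` is a subgroup (`toSubgroup`; inverses are powers,
`exists_pow_eq_one_of_mem`),
`L` is finite Galois over the fixed field `L^G` (Artin, Mathlib `FixedPoints`), a primitive element `θ` of `L | L^G`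
has trivial stabiliser.
In the two-storey tame cell this is applied to the RESIDUE FIELD of `O′` with the automorphisms induced by the
decomposition group: a lift of `θ`,
summed over the inertia group, is the residually separating element `x ∈ O′ ∩ K_T` that the Lagrange descent
(`InvariantDescentLU3`) needs.
Also: every member of such a family has finite order (`exists_pow_eq_one_of_mem`) — the input of
`InertiaIsotypicStability.valuation_apply_eq`.
All [folklore].
-/

namespace Summit.ResolutionOfSingularities.ResolutionOfSingularities.Theorems.FiniteAutSeparator

universe u

variable {L : Type u} [Field L]

/-- Positive powers of a member of a composition-closed finite family stay in the family. [folklore] -/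
theorem pow_succ_mem (G : Finset (L ≃+* L)) (hmul : ∀ a ∈ G, ∀ b ∈ G, a * b ∈ G) {g : L ≃+* L} (hg : g ∈ G)
    (n : ℕ) : g ^ (n + 1) ∈ G := by
  induction n with
  | zero => simpa using hg
  | succ n ih => rw [pow_succ]; exact hmul _ ih _ hg

/-- Every member of a composition-closed finite family of automorphisms has finite order. [folklore] -/
theorem exists_pow_eq_one_of_mem (G : Finset (L ≃+* L)) (hmul : ∀ a ∈ G, ∀ b ∈ G, a * b ∈ G) {g : L ≃+* L}
    (hg : g ∈ G) : ∃ n : ℕ, 0 < n ∧ g ^ n = 1 := by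
  obtain ⟨i, j, hij, heq⟩ := Finite.exists_ne_map_eq_of_infinite
    (fun n : ℕ => (⟨g ^ (n + 1), pow_succ_mem G hmul hg n⟩ : (G : Set (L ≃+* L))))
  have heq' : g ^ (i + 1) = g ^ (j + 1) := congrArg Subtype.val heq
  have aux : ∀ i j : ℕ, i < j → g ^ (i + 1) = g ^ (j + 1) → ∃ n : ℕ, 0 < n ∧ g ^ n = 1 := by
    intro i j hlt he
    refine ⟨j - i, Nat.sub_pos_of_lt hlt, ?_⟩
    have : g ^ (i + 1) * g ^ (j - i) = g ^ (i + 1) * 1 := by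
      rw [mul_one, ← pow_add, show i + 1 + (j - i) = j + 1 by omega, he]
    exact mul_left_cancel this
  rcases Nat.lt_or_gt_of_ne hij with h | h
  · exact aux i j h heq'
  · exact aux j i h heq'.symm

/-- … hence its inverse lies in the family. [folklore] -/
theorem inv_mem_of_mem (G : Finset (L ≃+* L)) (h1 : (1 : L ≃+* L) ∈ G) (hmul : ∀ a ∈ G, ∀ b ∈ G, a * b ∈ G)
    {g : L ≃+* L} (hg : g ∈ G) : g⁻¹ ∈ G := by
  obtain ⟨n, hn, hgn⟩ := exists_pow_eq_one_of_mem G hmul hg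
  have hinv : g⁻¹ = g ^ (n - 1) := by
    refine inv_eq_of_mul_eq_one_right ?_
    rw [← pow_succ', Nat.sub_add_cancel hn, hgn]
  rw [hinv]
  obtain ⟨m, hm⟩ : ∃ m, n - 1 = m := ⟨_, rfl⟩
  rcases m with _ | m
  · rw [hm, pow_zero]; exact h1
  · rw [hm]; exact pow_succ_mem G hmul hg m

/-- The family as a subgroup of `L ≃+* L`. [folklore] -/
def toSubgroup (G : Finset (L ≃+* L)) (h1 : (1 : L ≃+* L) ∈ G) (hmul : ∀ a ∈ G, ∀ b ∈ G, a * b ∈ G) :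
    Subgroup (L ≃+* L) where
  carrier := (G : Set (L ≃+* L))
  one_mem' := h1
  mul_mem' ha hb := hmul _ ha _ hb
  inv_mem' ha := inv_mem_of_mem G h1 hmul ha

/-- `mem_toSubgroup_iff`: Auxiliary step of this node's calculus, VERBATIM from the lens file (see the module
docstring); the statement is its type. [folklore] -/
theorem mem_toSubgroup_iff {G : Finset (L ≃+* L)} {h1 : (1 : L ≃+* L) ∈ G} {hmul : ∀ a ∈ G, ∀ b ∈ G, a * b ∈ G}
    {g : L ≃+* L} : g ∈ toSubgroup G h1 hmul ↔ g ∈ G := Iff.rfl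

/-- `finite_toSubgroup`: Auxiliary step of this node's calculus, VERBATIM from the lens file (see the module
docstring); the statement is its type. [folklore] -/
theorem finite_toSubgroup (G : Finset (L ≃+* L)) (h1 : (1 : L ≃+* L) ∈ G) (hmul : ∀ a ∈ G, ∀ b ∈ G, a * b ∈ G) :
    Finite (toSubgroup G h1 hmul) :=
  (G.finite_toSet).to_subtype

/-- **A simultaneous separator.**  For a finite composition-closed family `G ∋ 1` of automorphisms of a field `L`
there is `θ ∈ L` with
`g θ = θ → g = 1` for every `g ∈ G` (a primitive element of `L` over the fixed field `L^G`). [folklore; Artin +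
primitive element theorem] [folklore] -/
theorem exists_separator (G : Finset (L ≃+* L)) (h1 : (1 : L ≃+* L) ∈ G) (hmul : ∀ a ∈ G, ∀ b ∈ G, a * b ∈ G) :
    ∃ θ : L, ∀ g ∈ G, g θ = θ → g = 1 := by
  classical
  haveI := finite_toSubgroup G h1 hmul
  set H := toSubgroup G h1 hmul with hH
  set F₀ := FixedPoints.subfield H L with hF₀
  obtain ⟨θ, hθ⟩ := Field.exists_primitive_element F₀ L
  refine ⟨θ, fun g hg hgθ => ?_⟩
  -- the fixed set of `g`, an intermediate field over `L^H`
  let Kg : IntermediateField F₀ L :=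
    { carrier := {y | g y = y}
      mul_mem' := fun {a b} ha hb => by
        simp only [Set.mem_setOf_eq] at ha hb ⊢; rw [map_mul, ha, hb]
      one_mem' := by simp
      add_mem' := fun {a b} ha hb => by
        simp only [Set.mem_setOf_eq] at ha hb ⊢; rw [map_add, ha, hb]
      zero_mem' := by simp
      algebraMap_mem' := fun a => by
        change g (a : L) = a
        exact a.2 ⟨g, hg⟩
      inv_mem' := fun y hy => by
        simp only [Set.mem_setOf_eq] at hy ⊢; rw [map_inv₀, hy] }
  have hle := (IntermediateField.adjoin_simple_le_iff (K := Kg) (α := θ)).mpr hgθ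
  rw [hθ] at hle
  exact RingEquiv.ext fun y => hle (IntermediateField.mem_top (x := y))

end Summit.ResolutionOfSingularities.ResolutionOfSingularities.Theorems.FiniteAutSeparator
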